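import Summits.BirchSwinnertonDyer.BirchSwinnertonDyer.Theorems.EisensteinPrimesBSDpOnCellCImprimitiveCountSplitOfBrHlatLightTC
import HarnessLib

/-!
# Crux 4 `BSDpOnCellC` (stmt-BirchSwinnertonDyer-19034), line crystal v7 → v9 — the LIGHT split hlat-count with [BR𝟙] NARROWED to the ANOMALOUS
# type ([BR𝟙-anom] = Keller–Yin Thm. 1.2.2's extension, the statement's genuinely preprint-grade part)
# (cell `bsd-eis`, width seat `bsd-line-x2-p2` gen 12; skeleton UNCHANGED, W-79; division of labour agreed with the LEAD `cruxlead-19034` g0, bus 02:14:35Z)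

WHY. After this seat's p688155 ([BRω-mult] from print) and p689087 (the non-split count from print), crystal's [BR𝟙] `stub_wallAlgebraic.1 =
∀ p, CharMainConjOnTree p` is consumed by the SPLIT side only: by the light split count (p684434 / p686519 `_tc`, at the member `θq` unramified at
`p`) and by the LEAD's p684188 (Keller–Yin Lemma 5.1.1's split half). At a SPLIT multiplicative prime with the normalised (ramified) line, that
member has `θq|_{G_v̄} = 𝟙` — the ANOMALOUS type, OUTSIDE CGLS Thm. 1.2.2's printed regime, i.e. exactly Keller–Yin's extension. So the honest
text of the wall's first conjunct is `CharMainConjOnTree` RESTRICTED to `θ|_{G_v̄} = 𝟙`: [BR𝟙-anom]. This file re-derives the `_tc` split light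
count from [BR𝟙-anom] (hypothesis `hbrA`, the text a LEAD copies into `stub_wallAlgebraic.1`); the LEAD re-cuts p684188 to the same text.

RESULT. `imprimitiveCount_split_hlatLight_of_brAnom_of_pub_tc` — p686519's statement with `hbr` ↦ `hbrA`; binder list
`h263 h41 h42 h5A h32 hF1 hbrA hω han`. The anomalous clause for `θq|_K` at `v̄` is PROVED inside (split Tate datum + orientation); the rest of the
proof is p686519's token for token. CURRENCY NOTE: [BR𝟙-anom] keeps `CharMainConjOnTree`'s UNRAMIFIED duals (`𝓕_nr`, Keller–Yin's), not the
strict duals of this seat's PUB facts — at an anomalous `v̄` the strict and unramified Selmer groups differ (`H¹(G_{v̄}/I_{v̄}, (F/𝒪)(θ))` has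
corank one when `θ|_{G_v̄} = 𝟙`), and Keller–Yin's `λ(𝔛^{nr}_θ) = λ(𝓛_θ) + [θ|_{G_K} = 𝟙]` is the `𝓕_nr` statement.

HONEST FRAMING: helper theorem only (0 defs, 0 named facts introduced, 0 sorry); CONDITIONAL on five PUB named facts + CGLS Thm. 2.1.2 (`hF1`), on
the inline [BR𝟙-anom] (`hbrA`, Keller–Yin PREPRINT grade) and the inline light [BRω-split] / [AN-split] sentences; closes no stub by itself; no
summit statement / BSD / MC / IMC is proved for any curve; 0 cells / labels / tiers move.

References: [KellerYin2024] Thm. 1.2.2, Rem. 1.2.3, Prop. 1.2.5, §2.3, Lemma 5.1.2, §5.1 (b) (arXiv:2402.12781v2); [CastellaGrossiLeeSkinner2022]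
Thm. 1.2.2, Prop. 1.2.5, Thm. 2.1.2, Thm. 2.2.2; [Greenberg2016Selmer] Prop. 2.6.3; [Greenberg2006] Props. 3.2, 4.1, 4.2, §5 A; [GreenbergVatsal2000]
§2; p684434 (g11), p686519, p688155, p688467, p689087 (g12), p670160 (g9 `charHypotheses_of_split`), p675389 (g10 `SplitMultOrientation`).
-/

set_option autoImplicit false
set_option linter.dupNamespace false -- the summit namespace `…BirchSwinnertonDyer.BirchSwinnertonDyer.Theorems` (Sub = Summit, D-0017) trips it

noncomputable section

open scoped Classical MatrixGroups ModularForm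

open CongruenceSubgroup WeierstrassCurve NumberField IsDedekindDomain Field PowerSeries
  Literature.NumberTheory.EllipticCurves Literature.NumberTheory.EllipticCurves.GreenbergSelmer
  Literature.NumberTheory.EllipticCurves.ModularForms Literature.NumberTheory.QuadraticFields
  Literature.NumberTheory.EllipticCurves.Rank1Residual
  Literature.NumberTheory.EllipticCurves.Rank1Residual.Typed
  Literature.NumberTheory.EllipticCurves.KrizLi2019
  Literature.NumberTheory.EllipticCurves.GreenbergVatsal2000
  Literature.NumberTheory.EllipticCurves.Wuthrich2014
  Literature.NumberTheory.EllipticCurves.SteinWuthrich2013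
  Literature.NumberTheory.EllipticCurves.Castella2018Exceptional
  Literature.NumberTheory.EllipticCurves.Castella2018
  Literature.NumberTheory.GaloisRepresentations Literature.NumberTheory.GaloisCohomology
  Literature.NumberTheory.Automorphic
  Literature.NumberTheory.EllipticCurves.CastellaGrossiLeeSkinner2022
  Literature.NumberTheory.IwasawaTheory Literature.NumberTheory.IwasawaTheory.Greenberg2016
  Literature.NumberTheory.IwasawaTheory.Greenberg2006
  Summit.BirchSwinnertonDyer.Rank1Residual.X11b.AcSelmer
  Summit.BirchSwinnertonDyer.Rank1Residual.X11b.Halves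
  Summit.BirchSwinnertonDyer.Rank1Residual.X11b
  Summit.BirchSwinnertonDyer.Rank1Residual Summit.BirchSwinnertonDyer.Rank1Residual.X1
  Summit.BirchSwinnertonDyer.Rank1Residual.X1.KellerYinMuLambdaSplit
  Summit.BirchSwinnertonDyer.Rank1Residual.X2
  Summit.BirchSwinnertonDyer.BirchSwinnertonDyer.Theorems
  Summit.BirchSwinnertonDyer.BirchSwinnertonDyer.Theorems.EisensteinPrimesMuLambda
open Literature.NumberTheory.EllipticCurves.KellerYin2024

namespace Summit.BirchSwinnertonDyer.BirchSwinnertonDyer.Theorems.SplitMultWallHlatLight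

variable {p : ℕ} [hp : Fact p.Prime]

/-- **THE SPLIT CONJUNCT OF THE WALL AT THE NORMALISED LATTICE, LIGHT TELESCOPE, `cd_p ≤ 2` DISCHARGED, WITH [BR𝟙] NARROWED TO THE
ANOMALOUS TYPE** — `imprimitiveCount_split_hlatLight_of_br_of_pub_tc` (p686519) with its hypothesis `hbr : ∀ p, CharMainConjOnTree p` REPLACED by
**[BR𝟙-anom]** `hbrA` = `X1.KellerYinMuLambdaSplit.CharMainConjOnTree`'s body VERBATIM with ONE inserted binder, the ANOMALOUS clause at `v̄`:
`∀ g ∈ decomp vbar, ∀ m : charModule ∅ (θ.restrictField K), p • m = 0 → g • m = m` («`θ|_{G_v̄} = 𝟙`») — i.e. EXACTLY Keller–Yin's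
extension of CGLS Thm. 1.2.2 / Rubin to the anomalous character (arXiv:2402.12781v2 Thm. 1.2.2 + proof of Thm. 2.2.3: `Char(𝔛^{nr}_θ) = (𝓛_θ)`
resp. `(𝓛_𝟙·T)`), in the UNRAMIFIED-dual currency (`DatumDualData … bdpData … v̄`, Keller–Yin's `𝓕_nr`; NOT the strict dual, which differs
from it at an anomalous `v̄`). Everything else (statement, telescope, proof) VERBATIM p686519; the anomalous clause for the consumed member
`φ = θq` is supplied inside the proof: at a split multiplicative `p` the residual pair is `(ω, 𝟙)` or `(𝟙, ω)` at `v̄`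
(`ResidualDevissageSplitLocalData.charHypotheses_of_split`, x2-p2 g9, unconditional), and the second labelling is impossible because `θs|_K` is
ramified at `v̄` (`SplitMultOrientation.exists_mem_inertia_unitChar_ne_one_of_split_of_isUnramifiedAt` + `unitChar_eq_one_of_forall_torsion_smul_eq`).
So the split light count needs [BR𝟙] ONLY at the anomalous type; with x2-p2 g12's p688155/p689087 (non-split side from PRINT) a LEAD may
re-word `stub_wallAlgebraic.1` to the [BR𝟙-anom] text (`hbrA`'s type, to be copied token for token).
[claim: KellerYin2024, status: under-review] [cite: KellerYin2024, Thm. 1.2.2 (`Rubin Hida`, arXiv:2402.12781v2 TeX L676–683), Rem. 1.2.3, proof of Thm. 2.2.3 (L1450–1468) (shape only; the hypothesis `hbrA`)]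
[cite: KellerYin2024, §0.1 L263 and §1.3 L886 (the normalisation), Lemma 5.1.2 and §5.1 (b) (the wall; shape only), Thm. 1.4.1 (iii)]
[cite: CastellaGrossiLeeSkinner2022, Thm. 1.2.2, Prop. 1.2.5, Thm. 2.1.2, Thm. 2.2.2 with (2.16)] [cite: Greenberg2016Selmer, Prop. 2.6.3]
[cite: Greenberg2006, Props. 3.2, 4.1, 4.2, §5 A] [cite: GreenbergVatsal2000, §2 pp. 14–15] [cite: SilvermanATAEC1994, Ch. V Thm. 5.3 (split Tate curve)] -/
theorem imprimitiveCount_split_hlatLight_of_brAnom_of_pub_tc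
    (h263 : prop263_sur_of_crk) (h41 : prop41_globalEulerPoincareCorank)
    (h42 : prop42_localEulerPoincareCorank) (h5A : sec5A_localH2_subsingleton_of_LOC1)
    (h32 : prop32_cohomology_isCofinitelyGenerated)
    (hF1 : thm212_exists_isKatzLFunction)
    (hbrA : ∀ (p : ℕ) [Fact p.Prime],
      2 < p → ∀ (K : Type) [Field K] [NumberField K], IsImaginaryQuadratic K →
        SatisfiesHeegnerHypothesis p K → Odd (NumberField.discr K) → NumberField.discr K ≠ -3 →
      ∀ (ι : K →+* ℚ_[p]) (v vbar : HeightOneSpectrum (𝓞 K)),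
        (∀ x : 𝓞 K, x ∈ v.asIdeal ↔ ‖ι (x : K)‖ < 1) →
        ((p : ℕ) : 𝓞 K) ∈ vbar.asIdeal → vbar ≠ v →
      ∀ (κ : ZpExtension K p), κ.IsAnticyclotomic →
      ∀ (γ : absoluteGaloisGroup K) [Fact (κ.IsTopGenerator γ)],
      ∀ (ι' : PadicAlgCl p ≃+* ℂ),
        (∀ (w : InfinitePlace K) (k : 𝓞 K), k ∈ v.asIdeal ↔ ‖ι'.symm (w.embedding (k : K))‖ < 1) →
      ∀ (θ : FramedGaloisRep ℚ (padicCoeffIntegers (∅ : Set (PadicAlgCl p))) 1),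
        (∀ σ : absoluteGaloisGroup ℚ, θ σ ^ (p - 1) = 1) →
      ∀ (C : ℕ), SatisfiesHeegnerHypothesis C K →
        (∀ u : HeightOneSpectrum (𝓞 ℚ), ((C : ℤ) : 𝓞 ℚ) ∉ u.asIdeal → θ.IsUnramifiedAt u) →
        (∀ u : HeightOneSpectrum (𝓞 ℚ), ((p : ℕ) : 𝓞 ℚ) ∈ u.asIdeal → θ.IsUnramifiedAt u) →
        (∀ g ∈ decomp vbar, ∀ m : charModule (∅ : Set (PadicAlgCl p)) (θ.restrictField K), p • m = 0 → g • m = m) →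
      ∀ (θK : HeckeCharacter K), IsHeckeCharOf ι' (θ.restrictField K) θK →
      ∀ (D : DatumDualData κ γ (charModule (∅ : Set (PadicAlgCl p)) (θ.restrictField K))
          (Castella2018.AcSelmer.bdpData (charModule (∅ : Set (PadicAlgCl p)) (θ.restrictField K)) p vbar)
          (∅ : Set (HeightOneSpectrum (𝓞 K)))),
      ∀ (Cbar : Finset (HeightOneSpectrum (𝓞 K))), (∀ u ∈ Cbar, ¬ θK.IsUnramifiedAt u) →
      ∀ (ΩK : ℂ) (Ωp : (unrIntegers p)ˣ) (L : UnrSeries p), ΩK ≠ 0 →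
        IsKatzLFunction ι' v vbar Cbar κ γ θK ΩK ((Ωp : unrIntegers p) : ℂ_[p]) L →
      Module.Finite (IwasawaAlgebra p) D.X ∧ Module.IsTorsion (IwasawaAlgebra p) D.X ∧
        muInvariant p D.X = 0 ∧
        ∃ m : ℕ, FirstUnitCoeffAt L m ∧
          lambdaInvariant p D.X =
            m + (if ∀ σ : absoluteGaloisGroup K, θ.restrictField K σ = 1 then 1 else 0))
    (hω :
      (∀ (W : WeierstrassCurve ℚ) [W.IsElliptic] [W.IsGloballyMinimal] (p : ℕ) [Fact p.Prime],
        ∀ (N : ℕ) [NeZero N] (K : Type) [Field K] [NumberField K],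
          CellC W p → W.HasSplitMultiplicativeReductionAtPrime p → W.conductorNorm ℤ = N →
          IsImaginaryQuadratic K → NumberField.discr K < -4 → SatisfiesHeegnerHypothesis N K →
          Odd (NumberField.discr K) →
          ∀ (κ : ZpExtension K p), κ.IsAnticyclotomic →
            ∀ (γ : Field.absoluteGaloisGroup K) [Fact (κ.IsTopGenerator γ)]
              (𝔭 : HeightOneSpectrum (𝓞 K)), ((p : ℕ) : 𝓞 K) ∈ 𝔭.asIdeal →
              𝔭.asIdeal.ramificationIdx (𝓞 ℚ) = 1 → 𝔭.asIdeal.inertiaDeg (𝓞 ℚ) = 1 →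
              ∀ (𝔭bar : HeightOneSpectrum (𝓞 K)), ((p : ℕ) : 𝓞 K) ∈ 𝔭bar.asIdeal → 𝔭bar ≠ 𝔭 →
                ((Ideal.span {(p : ℤ)}).primesOver (𝓞 K)).ncard = 2 →
              ∀ (ι' : PadicAlgCl p ≃+* ℂ),
                  (∀ (w : InfinitePlace K) (k : 𝓞 K),
                    k ∈ 𝔭.asIdeal ↔ ‖ι'.symm (w.embedding (k : K))‖ < 1) →
                      ∀ (Φ : AddSubgroup (geomTorsion W (p : ℤ))), IsRationalLine W p Φ →
                      ∀ (θsub θquot : FramedGaloisRep ℚ (padicCoeffIntegers (∅ : Set (PadicAlgCl p))) 1),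
                        IsTeichmullerLiftOn (∅ : Set (PadicAlgCl p)) (Φ.map (geomTorsion W (p : ℤ)).subtype) θsub →
                        IsTeichmullerLiftOnQuot (∅ : Set (PadicAlgCl p)) (Φ.map (geomTorsion W (p : ℤ)).subtype)
                          (geomTorsion W (p : ℤ)) θquot →
                      ∀ (φ ψ : FramedGaloisRep ℚ (padicCoeffIntegers (∅ : Set (PadicAlgCl p))) 1),
                        (φ = θsub ∧ ψ = θquot ∨ φ = θquot ∧ ψ = θsub) →
                        (∀ u : HeightOneSpectrum (𝓞 ℚ), ((p : ℕ) : 𝓞 ℚ) ∈ u.asIdeal → φ.IsUnramifiedAt u) →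
                      ∀ (θK : HeckeCharacter K), IsHeckeCharOf ι' (φ.restrictField K) θK →
                      ∀ (Cbar : Finset (HeightOneSpectrum (𝓞 K))), (∀ u ∈ Cbar, ¬ θK.IsUnramifiedAt u) →
                      ∀ (ΩK' : ℂ) (Ωp' : (unrIntegers p)ˣ) (Lφ : UnrSeries p), ΩK' ≠ 0 →
                        IsKatzLFunction ι' 𝔭 𝔭bar Cbar κ γ θK ΩK' ((Ωp' : unrIntegers p) : ℂ_[p]) Lφ →
                      ∀ nφ : ℕ, FirstUnitCoeffAt Lφ nφ →
                      ∀ (Dψ : DatumDualData κ γ (charModule (∅ : Set (PadicAlgCl p)) (ψ.restrictField K))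
                          (Castella2018.AcSelmer.bdpData (charModule (∅ : Set (PadicAlgCl p)) (ψ.restrictField K)) p 𝔭bar)
                          (∅ : Set (HeightOneSpectrum (𝓞 K)))),
                        Module.Finite (IwasawaAlgebra p) Dψ.X ∧ Module.IsTorsion (IwasawaAlgebra p) Dψ.X ∧
                          muInvariant p Dψ.X = 0 ∧ lambdaInvariant p Dψ.X = nφ))
    (han :
      (∀ (W : WeierstrassCurve ℚ) [W.IsElliptic] [W.IsGloballyMinimal] (p : ℕ) [Fact p.Prime],
        ∀ (N : ℕ) [NeZero N] (K : Type) [Field K] [NumberField K],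
          CellC W p → W.HasSplitMultiplicativeReductionAtPrime p → W.conductorNorm ℤ = N →
          IsImaginaryQuadratic K → NumberField.discr K < -4 → SatisfiesHeegnerHypothesis N K →
          Odd (NumberField.discr K) →
          ∀ (κ : ZpExtension K p), κ.IsAnticyclotomic →
            ∀ (γ : Field.absoluteGaloisGroup K) [Fact (κ.IsTopGenerator γ)]
              (𝔭 : HeightOneSpectrum (𝓞 K)), ((p : ℕ) : 𝓞 K) ∈ 𝔭.asIdeal →
              𝔭.asIdeal.ramificationIdx (𝓞 ℚ) = 1 → 𝔭.asIdeal.inertiaDeg (𝓞 ℚ) = 1 →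
              ∀ (𝔭bar : HeightOneSpectrum (𝓞 K)), ((p : ℕ) : 𝓞 K) ∈ 𝔭bar.asIdeal → 𝔭bar ≠ 𝔭 →
                ((Ideal.span {(p : ℤ)}).primesOver (𝓞 K)).ncard = 2 →
              ∀ (f : CuspForm (CongruenceSubgroup.Gamma0 N) 2), IsNewformOf W f →
                ∀ (ι' : PadicAlgCl p ≃+* ℂ),
                  (∀ (w : InfinitePlace K) (k : 𝓞 K),
                    k ∈ 𝔭.asIdeal ↔ ‖ι'.symm (w.embedding (k : K))‖ < 1) →
                  ∀ (ΩK : ℂ) (Ωp : ℂ_[p]) (Q : PowerSeries 𝓞_ℂ_[p]), ΩK ≠ 0 → ‖Ωp‖ = 1 →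
                    R1.IsBDPLFunctionInt p ι' 𝔭 κ γ f ΩK Ωp Q →
                      ∀ (Sf : Finset (HeightOneSpectrum (𝓞 K))),
                      (∀ w : HeightOneSpectrum (𝓞 K), w ∈ Sf ↔
                        (((W.conductorNorm ℤ : ℤ) : 𝓞 K) ∈ w.asIdeal ∧ ((p : ℕ) : 𝓞 K) ∉ w.asIdeal)) →
                      ∀ (Φ : AddSubgroup (geomTorsion W (p : ℤ))), IsRationalLine W p Φ →
                      ∀ (θsub θquot : FramedGaloisRep ℚ (padicCoeffIntegers (∅ : Set (PadicAlgCl p))) 1),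
                        IsTeichmullerLiftOn (∅ : Set (PadicAlgCl p)) (Φ.map (geomTorsion W (p : ℤ)).subtype) θsub →
                        IsTeichmullerLiftOnQuot (∅ : Set (PadicAlgCl p)) (Φ.map (geomTorsion W (p : ℤ)).subtype)
                          (geomTorsion W (p : ℤ)) θquot →
                      ∀ (φ ψ : FramedGaloisRep ℚ (padicCoeffIntegers (∅ : Set (PadicAlgCl p))) 1),
                        (φ = θsub ∧ ψ = θquot ∨ φ = θquot ∧ ψ = θsub) →
                        (∀ u : HeightOneSpectrum (𝓞 ℚ), ((p : ℕ) : 𝓞 ℚ) ∈ u.asIdeal → φ.IsUnramifiedAt u) →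
                      ∀ (θK : HeckeCharacter K), IsHeckeCharOf ι' (φ.restrictField K) θK →
                      ∀ (Cbar : Finset (HeightOneSpectrum (𝓞 K))), (∀ u ∈ Cbar, ¬ θK.IsUnramifiedAt u) →
                      ∀ (ΩK' : ℂ) (Ωp' : (unrIntegers p)ˣ) (Lφ : UnrSeries p), ΩK' ≠ 0 →
                        IsKatzLFunction ι' 𝔭 𝔭bar Cbar κ γ θK ΩK' ((Ωp' : unrIntegers p) : ℂ_[p]) Lφ →
                      ∀ nφ : ℕ, FirstUnitCoeffAt Lφ nφ →
                      ∀ m : ℕ, ‖((PowerSeries.coeff m Q : 𝓞_ℂ_[p]) : ℂ_[p])‖ = 1 →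
                        (∀ i < m, ‖((PowerSeries.coeff i Q : 𝓞_ℂ_[p]) : ℂ_[p])‖ < 1) →
                          m + ∑ w ∈ Sf, curveLocalLambda κ (W.baseChange K) w ≤
                            2 * nφ + ∑ w ∈ Sf, (charLocalLambda (∅ : Set (PadicAlgCl p)) κ (θsub.restrictField K) w +
                              charLocalLambda (∅ : Set (PadicAlgCl p)) κ (θquot.restrictField K) w))) :
    ∀ (W : WeierstrassCurve ℚ) [W.IsElliptic] [W.IsGloballyMinimal] (p : ℕ) [Fact p.Prime],
      ∀ (N : ℕ) [NeZero N] (K : Type) [Field K] [NumberField K],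
        CellC W p → W.HasSplitMultiplicativeReductionAtPrime p →
        (∀ Φ : AddSubgroup (geomTorsion W (p : ℤ)), IsRationalLine W p Φ → ¬ LineUnramifiedAt W p Φ) →
        W.conductorNorm ℤ = N → IsImaginaryQuadratic K → NumberField.discr K < -4 → SatisfiesHeegnerHypothesis N K →
        Odd (NumberField.discr K) →
        ∀ (κ : ZpExtension K p), κ.IsAnticyclotomic →
          ∀ (γ : Field.absoluteGaloisGroup K) [Fact (κ.IsTopGenerator γ)]
            (𝔭 : HeightOneSpectrum (𝓞 K)), ((p : ℕ) : 𝓞 K) ∈ 𝔭.asIdeal →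
            𝔭.asIdeal.ramificationIdx (𝓞 ℚ) = 1 → 𝔭.asIdeal.inertiaDeg (𝓞 ℚ) = 1 →
            ∀ (𝔭bar : HeightOneSpectrum (𝓞 K)), ((p : ℕ) : 𝓞 K) ∈ 𝔭bar.asIdeal → 𝔭bar ≠ 𝔭 →
              ((Ideal.span {(p : ℤ)}).primesOver (𝓞 K)).ncard = 2 →
            ∀ (f : CuspForm (CongruenceSubgroup.Gamma0 N) 2), IsNewformOf W f →
              ∀ (ι' : PadicAlgCl p ≃+* ℂ),
                (∀ (w : InfinitePlace K) (k : 𝓞 K),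
                  k ∈ 𝔭.asIdeal ↔ ‖ι'.symm (w.embedding (k : K))‖ < 1) →
                ∀ (ΩK : ℂ) (Ωp : ℂ_[p]) (Q : PowerSeries 𝓞_ℂ_[p]), ΩK ≠ 0 → ‖Ωp‖ = 1 →
                  R1.IsBDPLFunctionInt p ι' 𝔭 κ γ f ΩK Ωp Q →
                    ∀ (Sf : Finset (HeightOneSpectrum (𝓞 K))),
                    (∀ w : HeightOneSpectrum (𝓞 K), w ∈ Sf ↔
                      (((W.conductorNorm ℤ : ℤ) : 𝓞 K) ∈ w.asIdeal ∧ ((p : ℕ) : 𝓞 K) ∉ w.asIdeal)) →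
                    ∀ m : ℕ, ‖((PowerSeries.coeff m Q : 𝓞_ℂ_[p]) : ℂ_[p])‖ = 1 →
                      (∀ i < m, ‖((PowerSeries.coeff i Q : 𝓞_ℂ_[p]) : ℂ_[p])‖ < 1) →
                        m + ∑ w ∈ Sf, curveLocalLambda κ (W.baseChange K) w ≤
                          lambdaInvariant p (XAc (W.baseChange K) p κ 𝔭bar (↑Sf : Set (HeightOneSpectrum (𝓞 K))) γ) := by
  intro W _ _ p _ N _ K _ _ hc hsplitred hlat hN hK hd4 hHN hodd κ hκ γ _ 𝔭 h𝔭 he1 hf1 𝔭bar h𝔭bar hne hsplit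
    f hf ι' hι' ΩK Ωp Q hΩK hΩp hQ Sf hSf m hm hlt
  have hp2 : 2 < p := by
    have hp' := (Fact.out : p.Prime).two_le
    rcases hp'.lt_or_eq with h | h
    · exact h
    · exact absurd h.symm hc.2.1
  have hp2' : p ≠ 2 := by omega
  have hred : Red W p := hc.2.2.1
  have hmult : Mult W p := hc.2.2.2
  haveI : IsGalois ℚ K := isGalois_of_finrank_eq_two K hK.1
  have hHN' : SatisfiesHeegnerHypothesis (W.conductorNorm ℤ) K := hN ▸ hHN
  have hγ : κ.IsTopGenerator γ := Fact.out
  have hHp : SatisfiesHeegnerHypothesis p K := fun q hq hqp ↦ by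
    rw [(Nat.prime_dvd_prime_iff_eq hq (Fact.out : p.Prime)).mp hqp]; exact hsplit
  have hd3 : NumberField.discr K ≠ -3 := by omega
  set ι : K →+* ℚ_[p] := X11b.embAt K p 𝔭 h𝔭 he1 hf1 with hιdef
  have hvι : ∀ x : 𝓞 K, x ∈ 𝔭.asIdeal ↔ ‖ι (x : K)‖ < 1 := X11b.mem_asIdeal_iff_norm_embAt_lt_one 𝔭 h𝔭 he1 hf1
  -- (hlat) ⟹ a unique rational line (p679932 §2)
  have huniq : ∀ Φ Φ' : AddSubgroup (geomTorsion W (p : ℤ)), IsRationalLine W p Φ → IsRationalLine W p Φ' → Φ = Φ' :=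
    fun Φ Φ' hΦ hΦ' ↦ SplitMultWallHlat.eq_of_isRationalLine_of_forall_not_lineUnramifiedAt W hp2' hmult hlat hΦ hΦ'
  -- the Teichmüller pair over `ℚ` of a rational line and its restriction to `K`
  obtain ⟨Φ, hΦ, θs, θq, hs, hq⟩ := exists_teichmullerPair W p hred
  have hpair : IsResidualPairOver (W.baseChange K) p (θs.restrictField K) (θq.restrictField K) :=
    isResidualPairOver_restrictField W p K hΦ hs hq
  have hcardΦ : Nat.card (Φ.map (geomTorsion W (p : ℤ)).subtype) = p := by
    rw [Nat.card_congr (Φ.equivMapOfInjective (geomTorsion W (p : ℤ)).subtype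
      (geomTorsion W (p : ℤ)).subtype_injective).toEquiv.symm, hΦ.1]
  -- ORIENTATION: `θq` is the member unramified at `p` (the line is ramified: (hlat)), `θs|_K` ramified at `v̄`
  have hφp : ∀ u : HeightOneSpectrum (𝓞 ℚ), ((p : ℕ) : 𝓞 ℚ) ∈ u.asIdeal → θq.IsUnramifiedAt u := by
    rcases TeichmullerPairUnramifiedAtMult.teichmullerPair_isUnramifiedAt_or W p hp2' hmult hΦ hs hq with h | h
    · exact absurd (SplitMultWall.lineUnramifiedAt_of_isUnramifiedAt W hs h) (hlat Φ hΦ)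
    · exact h
  have hramI : ∃ τ ∈ inertia 𝔭bar, unitChar (θs.restrictField K) τ ≠ 1 :=
    SplitMultOrientation.exists_mem_inertia_unitChar_ne_one_of_split_of_isUnramifiedAt W K hp2' hsplitred hK hsplit h𝔭 h𝔭bar hne hpair
      (SplitMultWall.isUnramifiedAt_restrictField_of_forall θq hφp h𝔭bar)
  -- THE ANOMALOUS CLAUSE for `φ = θq`: at a SPLIT multiplicative prime `D_{v̄}` acts trivially on `(F/𝒪)(θq|_K)[p]` (the residual pair is
  -- `(ω, 𝟙)` at `v̄`, x2-p2 g9's `charHypotheses_of_split`; the other labelling `(𝟙, ω)` is excluded because `θs|_K` is ramified at `v̄`)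
  have hTψK' : ∀ σ : absoluteGaloisGroup K, θs.restrictField K σ ^ (p - 1) = 1 := fun σ ↦ hs.1 _
  have htrivq : ∀ g ∈ decomp 𝔭bar, ∀ m : charModule (∅ : Set (PadicAlgCl p)) (θq.restrictField K), p • m = 0 → g • m = m := by
    rcases ResidualDevissageSplitLocalData.charHypotheses_of_split W K 𝔭bar hsplitred hK hsplit h𝔭bar (θs.restrictField K)
        (θq.restrictField K) hpair with ⟨htrivs, -⟩ | ⟨-, htrivq⟩
    · exfalso
      obtain ⟨τ, hτI, hτ⟩ := hramI
      exact hτ (CharGrSelmerCorankGeOfFacts.unitChar_eq_one_of_forall_torsion_smul_eq (θs.restrictField K) hTψK'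
        (htrivs τ (inertia_le_decomp 𝔭bar hτI)))
    · exact htrivq
  -- `E(K)[p] = 0` from the unique line moved by an inertia element at `v̄` (p678942)
  have htor : ∀ Q : (W.baseChange K).toAffine.Point, p • Q = 0 → Q = 0 := by
    obtain ⟨τ, -, hτ⟩ := hramI
    have hτ' : unitChar θs (absGaloisRestrict ℚ K τ) ≠ 1 := hτ
    exact SplitMultLatticeBinders.torsion_eq_zero_of_unique_rationalLine W K (fun Ψ hΨ ↦ huniq Ψ Φ hΨ hΦ)
      ⟨τ, SplitMultLatticeBinders.exists_smul_ne_of_unitChar_ne_one W hΦ hs hτ'⟩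
  -- `φ = θq` is Teichmüller and unramified off `N_E`
  have hTφ : ∀ σ : absoluteGaloisGroup ℚ, θq σ ^ (p - 1) = 1 := hq.1
  have hTφK : ∀ σ : absoluteGaloisGroup K, θq.restrictField K σ ^ (p - 1) = 1 := fun σ ↦ hTφ _
  have hunr : ∀ u : HeightOneSpectrum (𝓞 ℚ), ((W.conductorNorm ℤ : ℤ) : 𝓞 ℚ) ∉ u.asIdeal → θq.IsUnramifiedAt u := by
    intro u hu
    by_cases hpu : ((p : ℕ) : 𝓞 ℚ) ∈ u.asIdeal
    · exact hφp u hpu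
    · exact isUnramifiedAt_of_isTeichmullerLiftOnQuot W (∅ : Set (PadicAlgCl p)) hcardΦ hq
        (hasGoodReductionAt_of_conductorNorm_notMem W u hu) hpu
  -- the Hecke character `θ_K` of `φ|_{G_K}` and its Katz frame ([F1b])
  obtain ⟨θK, -, hθK'⟩ := exists_heckeCharacter_of_pow_eq_one (∅ : Set (PadicAlgCl p)) ι' (θq.restrictField K) hTφK
  have hθK : IsHeckeCharOf ι' (θq.restrictField K) θK := hθK'
  obtain ⟨ΩK₁, Ωp₁, L₁, hΩK₁, hL₁⟩ :=
    hF1 p hp2 K hK hHp hodd hd3 ι 𝔭 𝔭bar hvι h𝔭bar hne κ hκ γ ι' hι' θq hTφ (W.conductorNorm ℤ) hHN' hunr hφp θK hθK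
  have hCbar : ∀ u ∈ (∅ : Finset (HeightOneSpectrum (𝓞 K))), ¬ θK.IsUnramifiedAt u := by simp
  -- primitive unramified dual data of the two characters
  obtain ⟨D0sub⟩ := nonempty_unrDualData_char (∅ : Set (PadicAlgCl p)) (θs.restrictField K) κ 𝔭bar
    (∅ : Set (HeightOneSpectrum (𝓞 K))) hγ
  obtain ⟨D0quot⟩ := nonempty_unrDualData_char (∅ : Set (PadicAlgCl p)) (θq.restrictField K) κ 𝔭bar
    (∅ : Set (HeightOneSpectrum (𝓞 K))) hγ
  -- [BR𝟙] at `φ = θq`: [RH] for every primitive datum, and `λ(D0quot) = nφ + [θq|_K = 𝟙]`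
  obtain ⟨-, -, -, nφ, hnφ, hlamφ⟩ := hbrA p hp2 K hK hHp hodd hd3 ι 𝔭 𝔭bar hvι h𝔭bar hne κ hκ γ ι' hι' θq hTφ (W.conductorNorm ℤ)
    hHN' hunr hφp htrivq θK hθK D0quot ∅ hCbar ΩK₁ Ωp₁ L₁ hΩK₁ hL₁
  have hRHquot : ∀ D : DatumDualData κ γ (charModule (∅ : Set (PadicAlgCl p)) (θq.restrictField K))
      (Castella2018.AcSelmer.bdpData (charModule (∅ : Set (PadicAlgCl p)) (θq.restrictField K)) p 𝔭bar) (∅ : Set (HeightOneSpectrum (𝓞 K))),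
      Module.Finite (IwasawaAlgebra p) D.X ∧ Module.IsTorsion (IwasawaAlgebra p) D.X ∧ muInvariant p D.X = 0 := fun D ↦ by
    obtain ⟨h1, h2, h3, -⟩ := hbrA p hp2 K hK hHp hodd hd3 ι 𝔭 𝔭bar hvι h𝔭bar hne κ hκ γ ι' hι' θq hTφ (W.conductorNorm ℤ)
      hHN' hunr hφp htrivq θK hθK D ∅ hCbar ΩK₁ Ωp₁ L₁ hΩK₁ hL₁
    exact ⟨h1, h2, h3⟩
  -- [BRω-split] at `ψ = θs`: [RH] for every primitive datum, and `λ(D0sub) = nφ`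
  have hRHsub : ∀ D : DatumDualData κ γ (charModule (∅ : Set (PadicAlgCl p)) (θs.restrictField K))
      (Castella2018.AcSelmer.bdpData (charModule (∅ : Set (PadicAlgCl p)) (θs.restrictField K)) p 𝔭bar) (∅ : Set (HeightOneSpectrum (𝓞 K))),
      Module.Finite (IwasawaAlgebra p) D.X ∧ Module.IsTorsion (IwasawaAlgebra p) D.X ∧ muInvariant p D.X = 0 := fun D ↦ by
    obtain ⟨h1, h2, h3, -⟩ := hω W p N K hc hsplitred hN hK hd4 hHN hodd κ hκ γ 𝔭 h𝔭 he1 hf1 𝔭bar h𝔭bar hne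
      hsplit ι' hι' Φ hΦ θs θq hs hq θq θs (Or.inr ⟨rfl, rfl⟩) hφp θK hθK ∅ hCbar ΩK₁ Ωp₁ L₁ hΩK₁ hL₁ nφ hnφ D
    exact ⟨h1, h2, h3⟩
  obtain ⟨-, -, -, hlamψ⟩ := hω W p N K hc hsplitred hN hK hd4 hHN hodd κ hκ γ 𝔭 h𝔭 he1 hf1 𝔭bar h𝔭bar hne
    hsplit ι' hι' Φ hΦ θs θq hs hq θq θs (Or.inr ⟨rfl, rfl⟩) hφp θK hθK ∅ hCbar ΩK₁ Ωp₁ L₁ hΩK₁ hL₁ nφ hnφ D0sub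
  -- [AN-split]
  have h1 := han W p N K hc hsplitred hN hK hd4 hHN hodd κ hκ γ 𝔭 h𝔭 he1 hf1 𝔭bar h𝔭bar hne hsplit f hf ι' hι'
    ΩK Ωp Q hΩK hΩp hQ Sf hSf Φ hΦ θs θq hs hq θq θs (Or.inr ⟨rfl, rfl⟩) hφp θK hθK ∅ hCbar ΩK₁ Ωp₁ L₁ hΩK₁ hL₁ nφ hnφ m hm hlt
  -- the E-side cotorsion WITHOUT Keller–Yin Lemma 5.1.1: [RH] at `Sf` for both characters (∅ → Sf), then the residual dévissage
  obtain ⟨DSsub⟩ := nonempty_unrDualData_char (∅ : Set (PadicAlgCl p)) (θs.restrictField K) κ 𝔭bar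
    (↑Sf : Set (HeightOneSpectrum (𝓞 K))) hγ
  obtain ⟨DSquot⟩ := nonempty_unrDualData_char (∅ : Set (PadicAlgCl p)) (θq.restrictField K) κ 𝔭bar
    (↑Sf : Set (HeightOneSpectrum (𝓞 K))) hγ
  obtain ⟨hfgSs, htorSs, hμSs, -⟩ := SplitMultCharImprimitiveShift.imprimitive_clauses_of_split h263 h41 h42 h5A h32 W hp2 hsplitred hK hHN'
    hvι h𝔭bar hne κ hκ γ hpair Sf hSf (θs.restrictField K) (Or.inl rfl) hRHsub D0sub DSsub
  obtain ⟨hfgSq, htorSq, hμSq, -⟩ := SplitMultCharImprimitiveShift.imprimitive_clauses_of_split h263 h41 h42 h5A h32 W hp2 hsplitred hK hHN'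
    hvι h𝔭bar hne κ hκ γ hpair Sf hSf (θq.restrictField K) (Or.inr rfl) hRHquot D0quot DSquot
  have hTψK : ∀ σ : absoluteGaloisGroup K, θs.restrictField K σ ^ (p - 1) = 1 := fun σ ↦ hs.1 _
  obtain ⟨-, htorS, hμS⟩ := KellerYinLemma511OfCharRH.lemma511_conclusion_of_residualPair_of_dualData W hp2' hK h𝔭bar κ hκ γ Sf hSf
    hTψK hTφK hpair DSsub DSquot ⟨hfgSs, htorSs, hμSs⟩ ⟨hfgSq, htorSq, hμSq⟩
  have hfgS : Module.IsTorsion (IwasawaAlgebra p) (Castella2018.AcSelmer.XAc (W.baseChange K) p κ 𝔭bar (↑Sf : Set (HeightOneSpectrum (𝓞 K))) γ) :=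
    htorS
  haveI hfg : Module.Finite (IwasawaAlgebra p) (Castella2018.AcSelmer.XAc (W.baseChange K) p κ 𝔭bar (↑Sf : Set (HeightOneSpectrum (𝓞 K))) γ) :=
    Castella2018.AcSelmer.XAc.module_finite (W := W.baseChange K) (p := p) κ 𝔭bar (↑Sf : Set (HeightOneSpectrum (𝓞 K))) γ
      (Finset.finite_toSet Sf)
  -- the algebraic side at the split datum (the x1 index road run at the split prime); `cd_p G_{K,S} ≤ 2` is the
  -- tree theorem at the totally complex `K` (THE ONE CHANGE w.r.t. p684434)
  have h2 := SplitMultAlgebraicSide.lambdaInvariant_primitive_add_sum_le_of_split h263 h41 h42 h5A h32 W hp2 hsplitred hK 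
    (haveI := hK.2; groupCdLE_two_galoisGroupUnramifiedOutside_of_isTotallyComplex (K := K)) hHN' hsplit
    htor ι 𝔭 𝔭bar hvι h𝔭bar hne κ hκ γ (θs.restrictField K) (θq.restrictField K) hpair hramI Sf hSf D0sub D0quot hfg hfgS hμS hRHsub
    hRHquot
  rw [hlamφ, hlamψ] at h2
  have e : lambdaInvariant p (Castella2018.AcSelmer.XAc (W.baseChange K) p κ 𝔭bar (↑Sf : Set (HeightOneSpectrum (𝓞 K))) γ) =
      lambdaInvariant p (XAc (W.baseChange K) p κ 𝔭bar (↑Sf : Set (HeightOneSpectrum (𝓞 K))) γ) := rfl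
  rw [e] at h2
  omega

end Summit.BirchSwinnertonDyer.BirchSwinnertonDyer.Theorems.SplitMultWallHlatLight

end
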